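import Summits.Ventures.HodgeRepro2.T5SU11KernelCompositionStrictMono
import Summits.Ventures.HodgeRepro2.T5SU11KernelHilbertIdentity
import Summits.Ventures.HodgeRepro2.T5SU11ResolventIterateCommute

/-!
# Summary XXIV — strict sign and strict monotonicity of the composed kernels, Hilbert's identity and the commutation
of the resolvents at two spectral points (rows 594–597), under uniform names

Throughout `μ = λ(λ − 2)`, `λ(μ) = 1 + √(μ + 1)`, `K_λ` the kernel of `G^I_λ`, `K_λ^{∘(n+1)}(t, s) = (G^I_λ)ⁿ K_λ(·, s)(t)`
the composed kernels, `W_1 = {|g| ≤ D Ξ}` the ground-state space.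

* `iterate_signed_pos`, `kernel_comp_strict_alternating`, `kernel_comp_nonzero` — **`(−1)^{n+1} (G^I_λ)^{n+1} g > 0`** for a
  non-negative, somewhere positive `g ∈ W_1`, hence **`(−1)^{n+1} K_λ^{∘(n+1)}(t, s) > 0`**: the composed kernels alternate
  strictly in sign and never vanish (row 594);
* `kernel_comp_strictMono_mu`, `kernel_comp_strictMono_lam`, `kernel_strictMono_mu`, `kernel_strictMono_lam`, `kernel_lt_of_lt`
  — **`(−1)ⁿ K^{∘(n+1)}(t, s)` and the kernel `K_λ(t, s) < 0` itself are strictly increasing in `μ` on `(−1, ∞)` and in `λ`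
  on `(1, ∞)`**; `λ₂ < λ ⇒ K_{λ₂}(t, s) < K_λ(t, s) < 0` (row 595);
* `kernel_resolvent_integral`, `hilbert_identity`, `hilbert_identity'`, `kernel_integral_comm` — **Hilbert's resolvent identity
  for the kernels `K_λ(t, s) − K_{λ₂}(t, s) = (μ − μ₂) ∫ K_λ(t, r) K_{λ₂}(r, s) sinh 2r dr`** and the commutation of the kernels
  (row 596);
* `resolvent_comm`, `resolvent_iterate_comm`, `iterate_comm` — **`(G^I_λ)ᵐ (G^I_{λ₂})ⁿ g = (G^I_{λ₂})ⁿ (G^I_λ)ᵐ g` on `(0, ∞)`**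
  for `g ∈ W_1` (row 597).

Nothing is claimed about (N).

Blind lane: Mathlib + the HodgeRepro2 prefix only; no sorry; axioms ⊆ {propext, Classical.choice,
Quot.sound}.
-/

namespace Summit.Ventures.HodgeRepro2.T5SU11RadialSummaryXXIV

open Filter Topology MeasureTheory
open Set (Ioi Ioc Ioo)
open T5SU11Cartan T5SU11SphericalFunction T5SU11SphericalDecay T5SU11RadialGreenKernel T5SU11RadialGreenImproper
  T5SU11KernelCompositionStrictSign T5SU11KernelCompositionStrictMono T5SU11KernelHilbertIdentity
  T5SU11ResolventIterateCommute

section measure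

variable [MeasurableSpace Circle] [BorelSpace Circle]

section strict_sign

variable {lam : ℝ} (hlam : 1 < lam)

include hlam in
/-- **The signed iterates of a non-negative, somewhere positive `W_1` source are positive everywhere**:
`(−1)^{n+1} (G^I_λ)^{n+1} g(t) > 0` for every `n` and `t > 0` (row 594). -/
theorem iterate_signed_pos {g : ℝ → ℝ} (hg : ContinuousOn g (Ioi 0)) {D : ℝ}
    (hD : ∀ s, 0 < s → |g s| ≤ D * sph 1 (hyp s)) (hg0 : ∀ s, 0 < s → 0 ≤ g s) {t₀ : ℝ} (ht₀ : 0 < t₀)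
    (hgt₀ : 0 < g t₀) (n : ℕ) {t : ℝ} (ht : 0 < t) :
    0 < (-1 : ℝ) ^ (n + 1) * ((greenSolI (fun t => sph lam (hyp t)) (sphDecay lam))^[n + 1] g) t :=
  iterate_sign_pos_ground hlam hg hD hg0 ht₀ hgt₀ n ht

include hlam in
/-- **The composed kernels alternate strictly in sign**: `(−1)^{n+1} K_λ^{∘(n+1)}(t, s) > 0` for every `λ > 1`, `n` and
`t, s > 0` (row 594). -/
theorem kernel_comp_strict_alternating {s : ℝ} (hs : 0 < s) (n : ℕ) {t : ℝ} (ht : 0 < t) :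
    0 < (-1 : ℝ) ^ (n + 1)
      * ((greenSolI (fun t => sph lam (hyp t)) (sphDecay lam))^[n] (fun r => sphGreenKernel lam r s)) t :=
  kernel_comp_sign_pos hlam hs n ht

include hlam in
/-- The composed kernels never vanish on `(0, ∞)²` (row 594). -/
theorem kernel_comp_nonzero {s : ℝ} (hs : 0 < s) (n : ℕ) {t : ℝ} (ht : 0 < t) :
    ((greenSolI (fun t => sph lam (hyp t)) (sphDecay lam))^[n] (fun r => sphGreenKernel lam r s)) t ≠ 0 :=
  kernel_comp_ne_zero hlam hs n ht

end strict_sign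

section strict_mono

variable {s : ℝ} (hs : 0 < s)

include hs in
/-- **`(−1)ⁿ K_μ^{∘(n+1)}(t, s)` is strictly increasing in `μ` on `(−1, ∞)`** (row 595). -/
theorem kernel_comp_strictMono_mu (n : ℕ) {t : ℝ} (ht : 0 < t) :
    StrictMonoOn (fun μ => (-1 : ℝ) ^ n * ((greenSolI (fun t => sph (1 + Real.sqrt (μ + 1)) (hyp t))
      (sphDecay (1 + Real.sqrt (μ + 1))))^[n] (fun r => sphGreenKernel (1 + Real.sqrt (μ + 1)) r s)) t) (Ioi (-1)) :=
  kernel_comp_sign_strictMonoOn_mu hs n ht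

include hs in
/-- **`(−1)ⁿ K_λ^{∘(n+1)}(t, s)` is strictly increasing in `λ` on `(1, ∞)`** (row 595). -/
theorem kernel_comp_strictMono_lam (n : ℕ) {t : ℝ} (ht : 0 < t) :
    StrictMonoOn (fun lam => (-1 : ℝ) ^ n * ((greenSolI (fun t => sph lam (hyp t)) (sphDecay lam))^[n]
      (fun r => sphGreenKernel lam r s)) t) (Ioi 1) :=
  kernel_comp_sign_strictMonoOn_lam hs n ht

include hs in
/-- **The kernel is strictly increasing in `μ`** on `(−1, ∞)` (row 595). -/
theorem kernel_strictMono_mu {t : ℝ} (ht : 0 < t) :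
    StrictMonoOn (fun μ => sphGreenKernel (1 + Real.sqrt (μ + 1)) t s) (Ioi (-1)) :=
  kernel_strictMonoOn_mu hs ht

include hs in
/-- **The kernel is strictly increasing in `λ`** on `(1, ∞)` (row 595). -/
theorem kernel_strictMono_lam {t : ℝ} (ht : 0 < t) :
    StrictMonoOn (fun lam => sphGreenKernel lam t s) (Ioi 1) :=
  kernel_strictMonoOn_lam hs ht

include hs in
/-- **`λ₂ < λ ⇒ K_{λ₂}(t, s) < K_λ(t, s) < 0`** for `1 < λ₂`, `t, s > 0` (row 595). -/
theorem kernel_lt_of_lt {lam lam₂ : ℝ} (hlam₂ : 1 < lam₂) (hlt : lam₂ < lam) {t : ℝ} (ht : 0 < t) :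
    sphGreenKernel lam₂ t s < sphGreenKernel lam t s ∧ sphGreenKernel lam t s < 0 :=
  kernel_lt_kernel_of_lt hs hlam₂ hlt ht

end strict_mono

section hilbert

variable {lam lam₂ : ℝ} (hlam : 1 < lam) (hlam₂ : 1 < lam₂) {s : ℝ} (hs : 0 < s)

include hlam hlam₂ hs in
/-- **The resolvent applied to the kernel source, in integral form**:
`∫ K_λ(t, r) K_{λ₂}(r, s) sinh 2r dr = G^I_λ K_{λ₂}(·, s)(t)` (row 596). -/
theorem kernel_resolvent_integral {t : ℝ} (ht : 0 < t) :
    ∫ r in Ioi 0, sphGreenKernel lam t r * sphGreenKernel lam₂ r s * Real.sinh (2 * r)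
      = greenSolI (fun t => sph lam (hyp t)) (sphDecay lam) (fun r => sphGreenKernel lam₂ r s) t :=
  integral_kernel_mul_kernel_eq hlam hlam₂ hs ht

include hlam hlam₂ hs in
/-- **Hilbert's resolvent identity for the kernels**:
`K_λ(t, s) − K_{λ₂}(t, s) = (μ − μ₂) ∫ K_λ(t, r) K_{λ₂}(r, s) sinh 2r dr` for every `λ, λ₂ > 1` and `t, s > 0` (row 596). -/
theorem hilbert_identity {t : ℝ} (ht : 0 < t) :
    sphGreenKernel lam t s - sphGreenKernel lam₂ t s
      = (lam * (lam - 2) - lam₂ * (lam₂ - 2))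
        * ∫ r in Ioi 0, sphGreenKernel lam t r * sphGreenKernel lam₂ r s * Real.sinh (2 * r) :=
  kernel_hilbert_identity hlam hlam₂ hs ht

include hlam hlam₂ hs in
/-- Hilbert's identity with the kernels in the other order:
`K_λ(t, s) − K_{λ₂}(t, s) = (μ − μ₂) ∫ K_{λ₂}(t, r) K_λ(r, s) sinh 2r dr` (row 596). -/
theorem hilbert_identity' {t : ℝ} (ht : 0 < t) :
    sphGreenKernel lam t s - sphGreenKernel lam₂ t s
      = (lam * (lam - 2) - lam₂ * (lam₂ - 2))
        * ∫ r in Ioi 0, sphGreenKernel lam₂ t r * sphGreenKernel lam r s * Real.sinh (2 * r) :=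
  kernel_hilbert_identity' hlam hlam₂ hs ht

include hlam hlam₂ hs in
/-- **The resolvents at two spectral points commute, on the level of kernels**:
`∫ K_λ(t, r) K_{λ₂}(r, s) sinh 2r dr = ∫ K_{λ₂}(t, r) K_λ(r, s) sinh 2r dr` (row 596). -/
theorem kernel_integral_comm {t : ℝ} (ht : 0 < t) :
    ∫ r in Ioi 0, sphGreenKernel lam t r * sphGreenKernel lam₂ r s * Real.sinh (2 * r)
      = ∫ r in Ioi 0, sphGreenKernel lam₂ t r * sphGreenKernel lam r s * Real.sinh (2 * r) :=
  integral_kernel_mul_kernel_comm hlam hlam₂ hs ht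

end hilbert

section commute

variable {lam lam₂ : ℝ} (hlam : 1 < lam) (hlam₂ : 1 < lam₂)
variable {g : ℝ → ℝ} (hg : ContinuousOn g (Ioi 0)) {D : ℝ} (hD : ∀ s, 0 < s → |g s| ≤ D * sph 1 (hyp s))

include hlam hlam₂ hg hD in
/-- **The resolvents commute on `W_1`**: `G^I_λ (G^I_{λ₂} g)(t) = G^I_{λ₂} (G^I_λ g)(t)` for `t > 0` (row 597). -/
theorem resolvent_comm {t : ℝ} (ht : 0 < t) :
    greenSolI (fun t => sph lam (hyp t)) (sphDecay lam)
        (greenSolI (fun t => sph lam₂ (hyp t)) (sphDecay lam₂) g) t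
      = greenSolI (fun t => sph lam₂ (hyp t)) (sphDecay lam₂)
        (greenSolI (fun t => sph lam (hyp t)) (sphDecay lam) g) t :=
  greenSolI_comm_ground hlam hlam₂ hg hD ht

include hlam hlam₂ hg hD in
/-- **`G^I_λ (G^I_{λ₂})ⁿ g = (G^I_{λ₂})ⁿ G^I_λ g` on `(0, ∞)`** for `g ∈ W_1` (row 597). -/
theorem resolvent_iterate_comm (n : ℕ) {t : ℝ} (ht : 0 < t) :
    greenSolI (fun t => sph lam (hyp t)) (sphDecay lam)
        ((greenSolI (fun t => sph lam₂ (hyp t)) (sphDecay lam₂))^[n] g) t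
      = ((greenSolI (fun t => sph lam₂ (hyp t)) (sphDecay lam₂))^[n]
        (greenSolI (fun t => sph lam (hyp t)) (sphDecay lam) g)) t :=
  greenSolI_iterate_comm hlam hlam₂ hg hD n t ht

include hlam hlam₂ hg hD in
/-- **The powers of the resolvents at two spectral points commute**: `(G^I_λ)ᵐ (G^I_{λ₂})ⁿ g = (G^I_{λ₂})ⁿ (G^I_λ)ᵐ g` on
`(0, ∞)` for `g ∈ W_1` (row 597). -/
theorem iterate_comm (m n : ℕ) {t : ℝ} (ht : 0 < t) :
    ((greenSolI (fun t => sph lam (hyp t)) (sphDecay lam))^[m]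
        ((greenSolI (fun t => sph lam₂ (hyp t)) (sphDecay lam₂))^[n] g)) t
      = ((greenSolI (fun t => sph lam₂ (hyp t)) (sphDecay lam₂))^[n]
        ((greenSolI (fun t => sph lam (hyp t)) (sphDecay lam))^[m] g)) t :=
  iterate_iterate_comm hlam hlam₂ hg hD m n t ht

end commute

end measure

end Summit.Ventures.HodgeRepro2.T5SU11RadialSummaryXXIV
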